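import Summits.CriticalPhenomena.CardyFormulaZ2.Theorems.CardyUniqueLimitCardyRigidityDriverInputs
import Summits.CriticalPhenomena.CardyFormulaZ2.Theorems.CardyUniqueLimitCardyRigidityKSRectangleExitBounded
import Literature.Probability.RandomPlanarGeometry.DrivingTailsFromExits
import HarnessLib

/-!
# The driving tails of the bond-`ℤ²` interfaces from Condition G2 in `ℍ`
(line `crossing-martingale`, crux `CardyRigidity`, stub A2 `stub_percDrivingTail`)

Crux `Summit.CriticalPhenomena.CardyFormulaZ2.Theses.CardyUniqueLimit.CardyRigidity`
(stmt-CriticalPhenomena-0746), line `crossing_martingale`.  Stub A2 `stub_percDrivingTail` is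
`∀ D E, ZdDiscretisationFamily D E → Driver.PercDrivingTail D E`: eventually-uniform
sub-exponential tails of the running maxima of the discrete capacity driving processes
`drivingFunction φ_k ∘ bondInterfaceIn D (E δ_k)` (Kemppainen–Smirnov, Ann. Probab. 45 (2017),
Prop. 3.8 (1)).  In print this is Prop. 3.7 (rectangle exits, from Condition G2) and eq. (10)
(a large driving value forces the curve to leave a rectangle through its sides).  This file
PROVES that implication for the bond-`ℤ²` interfaces read through chordal maps `φ_k` of
approximating domains under which they are box-tight, with, as hypothesis, the instances of
Condition G2 that the printed proof uses — read in `ℍ` through the `φ_k`, at macroscopic scale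
(inner radius `2√u`), at bounded real centres `|z₀| ≤ Z`, eventually in the mesh:

* `KSBridge.exitTail_zero_of_rectangleExit` — for a random Loewner pair `(W, γ̂)` from `0`
  (a.s. `γ̂` generates the chain of the continuous `W`, `W 0 = 0`; NO simplicity) and a
  measurable choice `crv` of classes of `γ̂|[0, u]` whose law satisfies the crossing bound (inner
  radius `2√u`, ratio `C > 1`) at the centres `|z₀| ≤ L`: `P{∃ r ≤ u, L ≤ |re γ̂(r)|} ≤
  4 exp(-(log 2/(2C)) L/√u)` (`KSBridge.measure_reach_abs_re_le_of_bddCentres` and the height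
  bound `Loewner.IsGeneratedByCurve.im_le_two_mul_sqrt`);
* `KSBridge.measure_exists_le_abs_driving_le_of_rectangleExit` — hence `P{∃ r ≤ u, λ ≤ |W r|} ≤
  4 e^{2c} exp(-(c/581) λ/√u)`, `c = log 2/(2C)`, given the bound at the centres `|z₀| ≤ λ/581`
  (KS's (10): `Loewner.IsGeneratedByCurve.exists_le_abs_re_of_le_abs_driving`);
* `Driver.ae_exists_pair_of_boxTight` — box tightness at every `ε` makes the interface a.s. the
  compactified image of a transient Loewner pair from `0` with Loewner transform its driving term;
* `Driver.percDrivingTail_of_halfPlaneG2` (system level; registered shape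
  `tail_percDrivingTail_of_halfPlaneG2`): box tightness + the half-plane crossing bound ⟹ the
  conclusion of `Driver.PercDrivingTail`, `K = 4 e^{2c}`, `r = c/(581 √(t+1))`, `n₀ = 0`.

So stub A2 reduces to Condition G2 of Kemppainen–Smirnov for the bond-`ℤ²` exploration
transported to `ℍ` through the approximating maps (Russo–Seymour–Welsh, domain Markov property
at the hitting times of closed sets, conformal transfer of KS §2.2), which is not in the tree;
the hypotheses of `Driver.PercDrivingTail` alone give only rate-free tightness
(`Theorems/CardyUniqueLimitCardyRigidityPercDrivingTight.lean`).  References: A. Kemppainen,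
S. Smirnov, Ann. Probab. 45 (2017), §2.2, §3.3 eq. (10), Prop. 3.7–3.8 (arXiv:1212.6215v3 p. 16).
-/

noncomputable section

open MeasureTheory Filter Set Topology Metric
open scoped NNReal ENNReal
open UpperHalfPlane (upperHalfPlaneSet)
open Literature.Probability Literature.Probability.RandomPlanarGeometry
  Literature.Probability.LatticeModels Literature.Probability.Percolation
open scoped Literature.Probability.RandomPlanarGeometry.PathBorel

namespace Summit.CriticalPhenomena.CardyFormulaZ2.Cruxes.CardyRigidity.CrossingMartingale
export Literature.Probability.Percolation (bondInterfaceIn bondInterfaceIn_apply)  -- buildfix 2026-08-20: alias to the OLD home (names ambiguous since the Literature migration); no declaration changes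

namespace KSBridge

open Loewner

variable {Ω : Type*} [MeasurableSpace Ω]

/-- Arithmetic of the rectangle-exit bound: `2 · 2^{-n} ≤ 4 exp(-(log 2/(2C)) L/v)` once
`L/(2Cv) - 1 ≤ n` (adapted from `DrivingTailsFromExits`). [folklore] -/
theorem two_mul_inv_two_pow_le {C L v : ℝ} (hC : 0 < C) (hv : 0 < v) {n : ℕ}
    (hn : L / (C * (2 * v)) - 1 ≤ n) :
    (2 : ℝ≥0∞) * 2⁻¹ ^ n ≤ ENNReal.ofReal (4 * Real.exp (-(Real.log 2 / (2 * C) * L / v))) := by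
  have h2 : (2 : ℝ≥0∞) * 2⁻¹ ^ n = ENNReal.ofReal (2 * (2 : ℝ) ^ (-(n : ℝ))) := by
    rw [ENNReal.ofReal_mul zero_le_two, ENNReal.ofReal_ofNat, Real.rpow_neg zero_le_two,
      Real.rpow_natCast, ENNReal.ofReal_inv_of_pos (by positivity), ENNReal.ofReal_pow zero_le_two,
      ENNReal.ofReal_ofNat, ENNReal.inv_pow]
  rw [h2]
  refine ENNReal.ofReal_le_ofReal ?_
  set x : ℝ := L / (C * (2 * v)) with hxdef
  have hx : Real.exp (-(Real.log 2 / (2 * C) * L / v)) = (2 : ℝ) ^ (-x) := by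
    rw [Real.rpow_def_of_pos two_pos]
    congr 1
    rw [hxdef]
    field_simp
  rw [hx]
  have h1 : (2 : ℝ) ^ (-(n : ℝ)) ≤ 2 ^ (1 - x) :=
    Real.rpow_le_rpow_of_exponent_le one_le_two (by linarith)
  have h3 : (2 : ℝ) ^ (1 - x) = 2 * 2 ^ (-x) := by rw [sub_eq_add_neg, Real.rpow_add two_pos, Real.rpow_one]
  linarith

/-- **Time zero, no simplicity: the exit tail of the curve from the rectangle-exit bound at
bounded centres** (Kemppainen–Smirnov Prop. 3.7 ⟹ the hypothesis of Prop. 3.8 (1)).  Let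
`(W, γ̂)` be a random Loewner pair — a.s. `γ̂(ω)` generates the chain of the continuous `W(ω)`,
`W(ω) 0 = 0` — `u > 0`, `C > 1`, `L > 0`, and `crv ω` a measurable choice of classes with a.s.
`(crv ω).source = 0`, `(crv ω).range = γ̂(ω)([0, u])`.  If the law `P ∘ crv⁻¹` satisfies the
boundary-annulus crossing bound (inner radius `2√u`, ratio `C`) at the real centres `|z₀| ≤ L`,
then `P{∃ r ≤ u, L ≤ |re γ̂(r)|} ≤ 4 exp(-(log 2/(2C)) L/√u)`: on this event `crv ω` starts at `0`,
reaches `{|re| ≥ L}` and stays in `{|im| ≤ 2√u}` (`im_le_two_mul_sqrt`), so with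
`n = ⌈L/(2C√u)⌉ - 1`, `x₀ = L - 2nC√u > 0` it lies in the event of
`measure_reach_abs_re_le_of_bddCentres`. [cite: KemppainenSmirnov2017, §3.3, Prop. 3.7 and Prop. 3.8 (proof)] -/
theorem exitTail_zero_of_rectangleExit (P : Measure Ω) [IsProbabilityMeasure P]
    {W : Ω → ℝ≥0 → ℝ} {γ : Ω → ℝ≥0 → ℂ}
    (hpair : ∀ᵐ ω ∂P, IsGeneratedByCurve (W ω) (γ ω) ∧ Continuous (W ω) ∧ W ω 0 = 0)
    {u : ℝ≥0} (hu : 0 < u) {C : ℝ} (hC : 1 < C)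
    (crv : Ω → CurveClass ℂ) (hcrv : AEMeasurable crv P)
    (hrep : ∀ᵐ ω ∂P, (crv ω).source = 0 ∧ (crv ω).range = (γ ω) '' Icc 0 u)
    {L : ℝ} (hL : 0 < L)
    (hG : ∀ F : Set ℂ, IsClosed F → F.Nonempty → ∀ z₀ : ℝ, |z₀| ≤ L → ∀ S : Set (CurveClass ℂ),
      MeasurableSet S →
      S ⊆ {p | Disjoint p.range (ball ((z₀ : ℝ) : ℂ) (C * (2 * Real.sqrt u)))} →
      P.map crv (CurveClass.stopAt F ⁻¹' S ∩
          {c | c.startFrom F ∈ CurveClass.crossingIn ((z₀ : ℝ) : ℂ) (2 * Real.sqrt u)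
            (C * (2 * Real.sqrt u)) univ}) ≤
        2⁻¹ * P.map crv (CurveClass.stopAt F ⁻¹' S)) :
    P {ω | ∃ r ≤ u, L ≤ |(γ ω r).re|} ≤
      ENNReal.ofReal (4 * Real.exp (-(Real.log 2 / (2 * C) * L / Real.sqrt u))) := by
  have hsu : 0 < Real.sqrt u := Real.sqrt_pos.2 (by exact_mod_cast hu)
  have hC0 : 0 < C := zero_lt_one.trans hC
  set u' : ℝ := 2 * Real.sqrt u with hu'def
  have hu' : 0 < u' := by positivity
  have hCu' : 0 < C * u' := mul_pos hC0 hu'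
  -- the number of lines and the threshold
  set x : ℝ := L / (C * u') with hxdef
  have hx : 0 < x := div_pos hL hCu'
  set N : ℕ := ⌈x⌉₊ with hNdef
  have hN : 1 ≤ N := Nat.one_le_iff_ne_zero.2 (Nat.ceil_pos.2 hx).ne'
  set n : ℕ := N - 1 with hndef
  have hn_real : (n : ℝ) = N - 1 := by rw [hndef, Nat.cast_sub hN, Nat.cast_one]
  have hn_lt : (n : ℝ) < x := by
    rw [hn_real]
    have := Nat.ceil_lt_add_one hx.le
    linarith
  have hn_ge : x - 1 ≤ n := by
    rw [hn_real]
    have := Nat.le_ceil x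
    linarith
  set x₀ : ℝ := L - n * (C * u') with hx₀def
  have hx₀ : 0 < x₀ := by
    have h1 : (n : ℝ) * (C * u') < x * (C * u') := mul_lt_mul_of_pos_right hn_lt hCu'
    have hxL : x * (C * u') = L := div_mul_cancel₀ L hCu'.ne'
    rw [hx₀def]
    linarith
  have hL_eq : x₀ + n * (C * u') = L := by rw [hx₀def]; ring
  have hZ : |x₀| + n * (C * u') ≤ L := by rw [abs_of_pos hx₀, hL_eq]
  -- Kemppainen–Smirnov's rectangle event and its bound
  set H : Set ℂ := {z : ℂ | x₀ + n * (C * u') ≤ |z.re|} with hHdef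
  set E : Set (CurveClass ℂ) := {c | |c.source.re| < x₀ ∧ (c.range ∩ H).Nonempty ∧
    (c.stopAt H).range ⊆ {z : ℂ | |z.im| ≤ u'}} with hEdef
  have hKS : P.map crv E ≤ 2 * 2⁻¹ ^ n * P.map crv univ :=
    measure_reach_abs_re_le_of_bddCentres (P.map crv) hC hu' hG x₀ hZ
  -- the exit event is carried into `E` by `crv`
  have hincl : P {ω | ∃ r ≤ u, L ≤ |(γ ω r).re|} ≤ P (crv ⁻¹' E) := by
    refine measure_mono_ae ?_
    filter_upwards [hpair, hrep] with ω hω hω' hmem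
    obtain ⟨hgen, hWc, -⟩ := hω
    obtain ⟨hsrc, hrange⟩ := hω'
    obtain ⟨r, hr, hLr⟩ := hmem
    refine ⟨?_, ?_, ?_⟩
    · rw [hsrc]
      simpa using hx₀
    · refine ⟨γ ω r, ?_, ?_⟩
      · rw [hrange]
        exact ⟨r, ⟨bot_le, hr⟩, rfl⟩
      · show x₀ + n * (C * u') ≤ |(γ ω r).re|
        rw [hL_eq]
        exact hLr
    · intro z hz
      have hz' := CurveClass.range_stopAt_subset H (crv ω) hz
      rw [hrange] at hz'
      obtain ⟨r', hr', rfl⟩ := hz'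
      show |(γ ω r').im| ≤ u'
      rw [abs_of_nonneg (hgen.2.2.1 r')]
      exact hgen.im_le_two_mul_sqrt hWc hr'.2
  calc P {ω | ∃ r ≤ u, L ≤ |(γ ω r).re|}
      ≤ P (crv ⁻¹' E) := hincl
    _ ≤ P.map crv E := Measure.le_map_apply hcrv E
    _ ≤ 2 * 2⁻¹ ^ n * P.map crv univ := hKS
    _ = 2 * 2⁻¹ ^ n := by
        rw [Measure.map_apply_of_aemeasurable hcrv MeasurableSet.univ, preimage_univ, measure_univ,
          mul_one]
    _ ≤ ENNReal.ofReal (4 * Real.exp (-(Real.log 2 / (2 * C) * L / Real.sqrt u))) :=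
        two_mul_inv_two_pow_le hC0 hsu (by rw [← hu'def]; exact hn_ge)

/-- **Kemppainen–Smirnov Prop. 3.8 (1) at time zero, no simplicity: the tail of the running
maximum of the driving function from the rectangle-exit bound at bounded centres.**  Under the
hypotheses of `exitTail_zero_of_rectangleExit` with the crossing bound at the centres
`|z₀| ≤ λ/581`, `P{∃ r ≤ u, λ ≤ |W r|} ≤ 4 e^{2c} exp(-(c/581) λ/√u)`, `c = log 2/(2C)`: for
`λ > 1162 √u`, `λ ≤ |W r₀|` with `r₀ ≤ u` forces `|re γ̂(s)| ≥ λ/581 - 2√u` for some `s ≤ r₀`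
(KS's (10)); for `λ ≤ 1162 √u` the bound is `≥ 1`. [cite: KemppainenSmirnov2017, §3.3 eq. (10), Prop. 3.7 and Prop. 3.8 (1)] -/
theorem measure_exists_le_abs_driving_le_of_rectangleExit (P : Measure Ω) [IsProbabilityMeasure P]
    {W : Ω → ℝ≥0 → ℝ} {γ : Ω → ℝ≥0 → ℂ}
    (hpair : ∀ᵐ ω ∂P, IsGeneratedByCurve (W ω) (γ ω) ∧ Continuous (W ω) ∧ W ω 0 = 0)
    {u : ℝ≥0} (hu : 0 < u) {C : ℝ} (hC : 1 < C)
    (crv : Ω → CurveClass ℂ) (hcrv : AEMeasurable crv P)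
    (hrep : ∀ᵐ ω ∂P, (crv ω).source = 0 ∧ (crv ω).range = (γ ω) '' Icc 0 u)
    (l : ℝ)
    (hG : ∀ F : Set ℂ, IsClosed F → F.Nonempty → ∀ z₀ : ℝ, |z₀| ≤ l / 581 →
      ∀ S : Set (CurveClass ℂ), MeasurableSet S →
      S ⊆ {p | Disjoint p.range (ball ((z₀ : ℝ) : ℂ) (C * (2 * Real.sqrt u)))} →
      P.map crv (CurveClass.stopAt F ⁻¹' S ∩
          {c | c.startFrom F ∈ CurveClass.crossingIn ((z₀ : ℝ) : ℂ) (2 * Real.sqrt u)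
            (C * (2 * Real.sqrt u)) univ}) ≤
        2⁻¹ * P.map crv (CurveClass.stopAt F ⁻¹' S)) :
    P {ω | ∃ r ≤ u, l ≤ |W ω r|} ≤
      ENNReal.ofReal (4 * Real.exp (2 * (Real.log 2 / (2 * C))) *
        Real.exp (-(Real.log 2 / (2 * C) / 581 * l / Real.sqrt u))) := by
  set c : ℝ := Real.log 2 / (2 * C) with hcdef
  have hC0 : 0 < C := zero_lt_one.trans hC
  have hc : 0 < c := by
    have := Real.log_pos one_lt_two
    positivity
  have hsu : 0 < Real.sqrt u := Real.sqrt_pos.2 (by exact_mod_cast hu)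
  rcases le_or_gt l (1162 * Real.sqrt u) with hsmall | hlarge
  · -- trivial regime: the bound is at least `1`
    calc P {ω | ∃ r ≤ u, l ≤ |W ω r|} ≤ P univ := measure_mono (subset_univ _)
      _ = 1 := measure_univ
      _ ≤ _ := by
          rw [← ENNReal.ofReal_one]
          refine ENNReal.ofReal_le_ofReal ?_
          have h1 : c / 581 * l / Real.sqrt u ≤ 2 * c := by
            rw [div_le_iff₀ hsu]
            have : c / 581 * l ≤ c / 581 * (1162 * Real.sqrt u) := by gcongr
            linarith
          have h2 : (1 : ℝ) ≤ Real.exp (2 * c) * Real.exp (-(c / 581 * l / Real.sqrt u)) := by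
            rw [← Real.exp_add]
            exact Real.one_le_exp (by linarith)
          nlinarith [Real.exp_nonneg (2 * c), Real.exp_nonneg (-(c / 581 * l / Real.sqrt u))]
  · -- KS's (10): a large driving value forces a far excursion of `re γ`
    set L : ℝ := l / 581 - 2 * Real.sqrt u with hLdef
    have hL : 0 < L := by
      have : 1162 * Real.sqrt u / 581 < l / 581 := by gcongr
      rw [hLdef]; linarith
    have hLl : L ≤ l / 581 := by rw [hLdef]; linarith [hsu.le]
    have hincl : P {ω | ∃ r ≤ u, l ≤ |W ω r|} ≤ P {ω | ∃ r ≤ u, L ≤ |(γ ω r).re|} := by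
      refine measure_mono_ae ?_
      filter_upwards [hpair] with ω hω hmem
      obtain ⟨hgen, hWc, -⟩ := hω
      obtain ⟨r₀, hr₀, hle⟩ := hmem
      have hsqrt : Real.sqrt r₀ ≤ Real.sqrt u := Real.sqrt_le_sqrt (by exact_mod_cast hr₀)
      have hL' : 0 < l / 581 - 2 * Real.sqrt r₀ := by linarith
      have hWr : 581 * (l / 581 - 2 * Real.sqrt r₀ + 2 * Real.sqrt r₀) ≤ |W ω r₀| := by
        have : 581 * (l / 581 - 2 * Real.sqrt r₀ + 2 * Real.sqrt r₀) = l := by ring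
        rwa [this]
      obtain ⟨s, hs, hs'⟩ := hgen.exists_le_abs_re_of_le_abs_driving hWc hL' hWr
      exact ⟨s, hs.trans hr₀, le_trans (by rw [hLdef]; linarith) hs'⟩
    have hG' : ∀ F : Set ℂ, IsClosed F → F.Nonempty → ∀ z₀ : ℝ, |z₀| ≤ L →
        ∀ S : Set (CurveClass ℂ), MeasurableSet S →
        S ⊆ {p | Disjoint p.range (ball ((z₀ : ℝ) : ℂ) (C * (2 * Real.sqrt u)))} →
        P.map crv (CurveClass.stopAt F ⁻¹' S ∩
            {c | c.startFrom F ∈ CurveClass.crossingIn ((z₀ : ℝ) : ℂ) (2 * Real.sqrt u)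
              (C * (2 * Real.sqrt u)) univ}) ≤
          2⁻¹ * P.map crv (CurveClass.stopAt F ⁻¹' S) :=
      fun F hF hFne z₀ hz₀ ↦ hG F hF hFne z₀ (hz₀.trans hLl)
    calc P {ω | ∃ r ≤ u, l ≤ |W ω r|}
        ≤ P {ω | ∃ r ≤ u, L ≤ |(γ ω r).re|} := hincl
      _ ≤ ENNReal.ofReal (4 * Real.exp (-(Real.log 2 / (2 * C) * L / Real.sqrt u))) :=
          exitTail_zero_of_rectangleExit P hpair hu hC crv hcrv hrep hL hG'
      _ = _ := by
          congr 1
          rw [← hcdef, mul_assoc, ← Real.exp_add]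
          congr 1
          rw [hLdef]
          field_simp
          ring

end KSBridge

namespace Driver

/-! ### Box tightness at every `ε`: the interface is a.s. the image of a Loewner pair from `0` -/

/-- **Almost surely the interface is the compactified image of a transient Loewner pair from
`0`, with Loewner transform its driving term**, as soon as for every `ε > 0` some
Kemppainen–Smirnov box event has probability `≥ 1 - ε` for the random curve class `Y`
(`drivingFunction_compactifiedClass`; the failure set has outer measure `≤ ε` for every `ε`).
[cite: KemppainenSmirnov2017, §3.5] -/
theorem ae_exists_pair_of_boxTight {Ω : Type*} [MeasurableSpace Ω] (P : Measure Ω)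
    {D : DobrushinDomain} {φ : ConformalEquiv upperHalfPlaneSet D.carrier}
    (hφ : D.IsChordalUniformizing φ) (Y : Ω → CurveClass ℂ)
    (hbox : ∀ ε : ℝ≥0∞, 0 < ε → ∃ (δγ δW : ℕ → ℝ) (T : ℕ → ℝ≥0), (∀ j, 0 < δγ j) ∧
      (∀ j, 0 < δW j) ∧
      P (Y ⁻¹' ((fun p ↦ compactifiedClass φ.boundaryExtension (D.pt 1) p.1) ''
        {p : C(ℝ≥0, ℂ) × C(ℝ≥0, ℝ) | p ∈ generatedPairs ∧
          p.1 ∈ Process.modulusSet ({0} : Set ℂ) δγ ∧ p.2 ∈ Process.modulusSet ({0} : Set ℝ) δW ∧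
          ∀ (j : ℕ) (t : ℝ≥0), T j ≤ t → (j : ℝ) ≤ ‖p.1 t‖})ᶜ) ≤ ε) :
    ∀ᵐ ω ∂P, ∃ p : C(ℝ≥0, ℂ) × C(ℝ≥0, ℝ), p ∈ generatedPairs ∧ p.1 0 = 0 ∧ p.2 0 = 0 ∧
      Y ω = compactifiedClass φ.boundaryExtension (D.pt 1) p.1 ∧ drivingFunction φ (Y ω) = p.2 := by
  rw [ae_iff]
  -- the failure set is inside every box-complement event
  have hle : ∀ ε : ℝ≥0∞, 0 < ε → P {ω | ¬ ∃ p : C(ℝ≥0, ℂ) × C(ℝ≥0, ℝ), p ∈ generatedPairs ∧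
      p.1 0 = 0 ∧ p.2 0 = 0 ∧ Y ω = compactifiedClass φ.boundaryExtension (D.pt 1) p.1 ∧
      drivingFunction φ (Y ω) = p.2} ≤ ε := by
    intro ε hε
    obtain ⟨δγ, δW, T, -, -, hP⟩ := hbox ε hε
    refine le_trans (measure_mono fun ω hω ↦ ?_) hP
    rintro ⟨p, hp, hpY⟩
    have htr : Tendsto (fun s ↦ ‖p.1 s‖) atTop atTop :=
      tendsto_atTop_atTop.2 fun r ↦ ⟨T ⌈r⌉₊, fun s hs ↦ (Nat.le_ceil r).trans (hp.2.2.2 _ s hs)⟩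
    refine hω ⟨p, hp.1, hp.2.1.1, hp.2.2.1.1, hpY.symm, ?_⟩
    rw [← hpY]
    exact drivingFunction_compactifiedClass hφ hp.1 htr
  by_contra hne
  obtain ⟨ε, hε0, hεlt⟩ := exists_between (pos_iff_ne_zero.2 hne)
  exact absurd (hle ε hε0) (not_le.2 hεlt)

/-! ### Kemppainen–Smirnov Prop. 3.7 ⟹ Prop. 3.8 (1) for the bond-`ℤ²` interfaces -/

/-- **Kemppainen–Smirnov Prop. 3.7 ⟹ Prop. 3.8 (1) for the bond-`ℤ²` interfaces.**  Through
chordal maps `φ_k` of approximating domains under which the interfaces are box-tight, the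
half-plane crossing bound (`hG`: Condition G2 in `ℍ` for the laws of the capacity-`u` truncations
of the pulled-back interfaces, ratio `C > 1`, centres `|z₀| ≤ Z`, eventually in `k`) gives, for
every `t`, `K = 4 e^{2c}`, `r = c/(581 √(t+1))` (`c = log 2/(2C)`) with
`P_{1/2}{∃ u ≤ t, n < |drivingFunction φ_k (bondInterfaceIn D (E δ_k)) u|} ≤ K e^{-r n}` for all
`n` and all large `k` (`ae_exists_pair_of_boxTight` and
`KSBridge.measure_exists_le_abs_driving_le_of_rectangleExit` on `[0, t+1]`, centres `≤ n/581`).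
[cite: KemppainenSmirnov2017, Prop. 3.7 and Prop. 3.8 (1)] -/
theorem percDrivingTail_of_halfPlaneG2 {D : DobrushinDomain} {E : ℝ → DiscreteDobrushin}
    {δs : ℕ → ℝ} {Ds : ℕ → DobrushinDomain}
    {φs : ∀ k, ConformalEquiv upperHalfPlaneSet (Ds k).carrier}
    (hφs : ∀ k, (Ds k).IsChordalUniformizing (φs k))
    (hbox : ∀ ε : ℝ≥0∞, 0 < ε → ∃ (δγ δW : ℕ → ℝ) (T : ℕ → ℝ≥0), (∀ j, 0 < δγ j) ∧
      (∀ j, 0 < δW j) ∧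
      ∀ k, bondPercolation (zdGraph 2) half ((bondInterfaceIn D (E (δs k))) ⁻¹'
        ((fun p ↦ compactifiedClass (φs k).boundaryExtension ((Ds k).pt 1) p.1) ''
          {p : C(ℝ≥0, ℂ) × C(ℝ≥0, ℝ) | p ∈ generatedPairs ∧
            p.1 ∈ Process.modulusSet ({0} : Set ℂ) δγ ∧
            p.2 ∈ Process.modulusSet ({0} : Set ℝ) δW ∧
            ∀ (j : ℕ) (t : ℝ≥0), T j ≤ t → (j : ℝ) ≤ ‖p.1 t‖})ᶜ) ≤ ε)
    {C : ℝ} (hC : 1 < C)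
    (hG : ∀ u : ℝ≥0, 0 < u → ∀ Z : ℝ, ∀ᶠ k in atTop,
      ∃ crv : BondConfig (Site 2) → CurveClass ℂ,
        AEMeasurable crv (bondPercolation (zdGraph 2) half) ∧
        (∀ᵐ ω ∂bondPercolation (zdGraph 2) half, (crv ω).source = 0 ∧
          (crv ω).range = (Loewner.trace
            (drivingFunction (φs k) (bondInterfaceIn D (E (δs k)) ω))) '' Icc 0 u) ∧
        ∀ F : Set ℂ, IsClosed F → F.Nonempty → ∀ z₀ : ℝ, |z₀| ≤ Z →
          ∀ S : Set (CurveClass ℂ), MeasurableSet S →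
          S ⊆ {p | Disjoint p.range (ball ((z₀ : ℝ) : ℂ) (C * (2 * Real.sqrt u)))} →
          (bondPercolation (zdGraph 2) half).map crv (CurveClass.stopAt F ⁻¹' S ∩
              {c | c.startFrom F ∈ CurveClass.crossingIn ((z₀ : ℝ) : ℂ) (2 * Real.sqrt u)
                (C * (2 * Real.sqrt u)) univ}) ≤
            2⁻¹ * (bondPercolation (zdGraph 2) half).map crv (CurveClass.stopAt F ⁻¹' S))
    (t : ℝ≥0) :
    ∃ (K r : ℝ) (n₀ : ℕ), 0 < r ∧ ∀ n : ℕ, n₀ ≤ n → ∀ᶠ k in atTop,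
      bondPercolation (zdGraph 2) half {ω | ∃ u, u ≤ t ∧
        (n : ℝ) < |drivingFunction (φs k) (bondInterfaceIn D (E (δs k)) ω) u|} ≤
        ENNReal.ofReal (K * Real.exp (-r * n)) := by
  set Pc : Measure (BondConfig (Site 2)) := bondPercolation (zdGraph 2) half with hPc
  haveI : IsProbabilityMeasure Pc := by rw [hPc]; infer_instance
  set u : ℝ≥0 := t + 1 with hudef
  have hu : 0 < u := by positivity
  have hsu : 0 < Real.sqrt u := Real.sqrt_pos.2 (by exact_mod_cast hu)
  set c : ℝ := Real.log 2 / (2 * C) with hcdef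
  have hC0 : 0 < C := zero_lt_one.trans hC
  have hc : 0 < c := by
    have := Real.log_pos one_lt_two
    positivity
  refine ⟨4 * Real.exp (2 * c), c / (581 * Real.sqrt u), 0, by positivity, fun n _ ↦ ?_⟩
  filter_upwards [hG u hu ((n : ℝ) / 581)] with k hk
  obtain ⟨crv, hcrv, hrep, hGk⟩ := hk
  -- the random Loewner pair at scale `k`
  set W : BondConfig (Site 2) → ℝ≥0 → ℝ :=
    fun ω ↦ drivingFunction (φs k) (bondInterfaceIn D (E (δs k)) ω) with hWdef
  set γ : BondConfig (Site 2) → ℝ≥0 → ℂ := fun ω ↦ Loewner.trace (W ω) with hγdef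
  have hpair : ∀ᵐ ω ∂Pc, Loewner.IsGeneratedByCurve (W ω) (γ ω) ∧ Continuous (W ω) ∧
      W ω 0 = 0 := by
    filter_upwards [ae_exists_pair_of_boxTight Pc (hφs k) (bondInterfaceIn D (E (δs k)))
      (fun ε hε ↦ (hbox ε hε).imp fun δγ ⟨δW, T, hδγ, hδW, hall⟩ ↦ ⟨δW, T, hδγ, hδW, hall k⟩)]
      with ω hω
    obtain ⟨p, hp, -, hp2, -, hWp⟩ := hω
    have hWω : W ω = p.2 := hWp
    have hgen : Loewner.IsGeneratedByCurve (W ω) p.1 := by rw [hWω]; exact hp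
    have hγω : γ ω = p.1 := by
      show Loewner.trace (W ω) = p.1
      exact Loewner.IsGeneratedByCurve.trace_eq_holds (by rw [hWω]; exact p.2.continuous) hgen
    refine ⟨by rw [hγω]; exact hgen, by rw [hWω]; exact p.2.continuous, by rw [hWω]; exact hp2⟩
  have htail := KSBridge.measure_exists_le_abs_driving_le_of_rectangleExit Pc hpair hu hC crv hcrv
    hrep n hGk
  -- the running maximum on `[0, t]` at strict level `n` is inside the event on `[0, t + 1]`
  have hincl : Pc {ω | ∃ u', u' ≤ t ∧
      (n : ℝ) < |drivingFunction (φs k) (bondInterfaceIn D (E (δs k)) ω) u'|} ≤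
      Pc {ω | ∃ r ≤ u, (n : ℝ) ≤ |W ω r|} := measure_mono fun ω ⟨u', hu', hlt⟩ ↦
    ⟨u', hu'.trans (by rw [hudef]; exact le_self_add), hlt.le⟩
  refine hincl.trans (htail.trans (le_of_eq ?_))
  rw [← hcdef]
  congr 1
  have hexp : -(c / 581 * (n : ℝ) / Real.sqrt u) = -(c / (581 * Real.sqrt u)) * n := by ring
  rw [hexp]

end Driver

/-- **Registered-shape form** (glue sub-goal `tail_percDrivingTail_of_halfPlaneG2` of
stmt-CriticalPhenomena-0746): for the bond-`ℤ²` interfaces of `(D, E)` along meshes `δ_k`, read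
through chordal maps `φ_k` of Dobrushin domains `D_k` under which they are box-tight, Condition
G2 in `ℍ` for the laws of the capacity-`u` truncations of the pulled-back interfaces (ratio
`C > 1`, inner radius `2√u`, centres `|z₀| ≤ Z`, eventually in `k`) implies the conclusion of
`Driver.PercDrivingTail D E` for this system. [cite: KemppainenSmirnov2017, Prop. 3.7 and Prop. 3.8 (1)] -/
theorem tail_percDrivingTail_of_halfPlaneG2 : ∀ (D : DobrushinDomain) (E : ℝ → DiscreteDobrushin) (δs : ℕ → ℝ) (Ds : ℕ → DobrushinDomain) (φs : ∀ k, ConformalEquiv upperHalfPlaneSet (Ds k).carrier), (∀ k, (Ds k).IsChordalUniformizing (φs k)) → (∀ ε : ℝ≥0∞, 0 < ε → ∃ (δγ δW : ℕ → ℝ) (T : ℕ → ℝ≥0), (∀ j, 0 < δγ j) ∧ (∀ j, 0 < δW j) ∧ ∀ k, bondPercolation (zdGraph 2) half ((bondInterfaceIn D (E (δs k))) ⁻¹' ((fun p ↦ compactifiedClass (φs k).boundaryExtension ((Ds k).pt 1) p.1) '' {p : C(ℝ≥0, ℂ) × C(ℝ≥0, ℝ) | p ∈ generatedPairs ∧ p.1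 ∈ Process.modulusSet ({0} : Set ℂ) δγ ∧ p.2 ∈ Process.modulusSet ({0} : Set ℝ) δW ∧ ∀ (j : ℕ) (t : ℝ≥0), T j ≤ t → (j : ℝ) ≤ ‖p.1 t‖})ᶜ) ≤ ε) → ∀ C : ℝ, 1 < C → (∀ u : ℝ≥0, 0 < u → ∀ Z : ℝ, ∀ᶠ k in atTop, ∃ crv : BondConfig (Site 2) → CurveClass ℂ, AEMeasurable crv (bondPercolation (zdGraph 2) half) ∧ (∀ᵐ ω ∂bondPercolation (zdGraph 2) half, (crv ω).source = 0 ∧ (crv ω).range = (Loewner.trace (drivingFunction (φs k) (bondInterfaceIn D (E (δs k)) ω))) '' Icc 0 u) ∧ ∀ F : Set ℂ, IsClosed F → F.Nonempty → ∀ z₀ : ℝ, |z₀| ≤ Z → ∀ S : Set (CurveClass ℂ), MeasurableSet S → S ⊆ {p | Disjoint p.range (ball ((z₀ : ℝ) : ℂ) (C * (2 * Real.sqrt u)))} → (bondPercolation (zdGraph 2) half).map crv (CurveClass.stopAt F ⁻¹' S ∩ {c | c.startFrom F ∈ CurveClass.crossingIn ((z₀ : ℝ) : ℂ) (2 * Real.sqrt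 u) (C * (2 * Real.sqrt u)) univ}) ≤ 2⁻¹ * (bondPercolation (zdGraph 2) half).map crv (CurveClass.stopAt F ⁻¹' S)) → ∀ t : ℝ≥0, ∃ (K r : ℝ) (n₀ : ℕ), 0 < r ∧ ∀ n : ℕ, n₀ ≤ n → ∀ᶠ k in atTop, bondPercolation (zdGraph 2) half {ω | ∃ u, u ≤ t ∧ (n : ℝ) < |drivingFunction (φs k) (bondInterfaceIn D (E (δs k)) ω) u|} ≤ ENNReal.ofReal (K * Real.exp (-r * n)) :=
  fun _ _ _ _ _ hφs hbox _ hC hG t ↦ Driver.percDrivingTail_of_halfPlaneG2 hφs hbox hC hG t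


end Summit.CriticalPhenomena.CardyFormulaZ2.Cruxes.CardyRigidity.CrossingMartingale

end
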